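import Summits.CriticalPhenomena.PercolationContinuityZ3.Theorems.PercNearOneGluingNoHeavyLowerTailCILTwoGate
import Summits.CriticalPhenomena.PercolationContinuityZ3.Theorems.PercNearOneGluingNoHeavyLowerTailCILEdgeRaising
import Summits.CriticalPhenomena.PercolationContinuityZ3.Theorems.PercNearOneGluingNoHeavyLowerTailRelayNeighbourhoodGluing
import Literature.Probability.Percolation.LonelyClusterExchange
import HarnessLib

/-!
# `NoHeavyLowerTail` (stmt-CriticalPhenomena-4575) — PENDANT PEELING: the STEP of `setCS_of_step` for observer sets
# with a pendant vertex

Prover `prim-gen-induct` (gen 6), `--supports stmt-CriticalPhenomena-4575`.  No definitions, no named facts, no sorries.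

Setting of the set-champion-stability induction (`…CILInductionStep.setCS_of_step`): `μ_w = prodBernoulli w` on `Fin n`,
relays `A`, level `j`, `I_w(x) = μ_w{|π(x)| ≤ j}`; `CS_w(S, c)` is the inequality
`μ_w(c ↮ S, 1 ≤ |π(S)| ≤ j) ≤ μ_w(c ↮ S, |π(c)| ≤ j)` for an observer set `S` disjoint from `A` and a witness `c`.

**Theorem (`PendantPeeling.step_of_pendant`).**  Let `S` be disjoint from `A`, `c ∈ A` a champion of `w`
(`I_w(a) ≤ I_w(c)` for all `a ∈ A`), `2 ≤ |S|`, and let `v ∈ S` be a PENDANT vertex: its only positive-weight pair is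
`s(v, g)` for one vertex `g ≠ v` (a relay, a Steiner vertex outside `S`, or a member of `S`).  If set-champion stability
holds for every champion of every weight function of smaller measure `μ(w') < μ(w)`
(`μ(w) = (|Sym2 (Fin n)| + 1)·#{w ≠ 0} + #{0 < w < 1}`, the induction measure of `setCS_of_step`) at every nonempty
observer set disjoint from `A`, then `CS_w(S, c)`.

Proof (crux notes BLOBQUOTIENT.md §25; the pendant-peeling identity was also found exactly by the census worker cp-mlm,
`run/shared/lean/ttrl/mlm/README.md` RESULT (2b)).  Put `e = s(v,g)`, `w₀ = w[e ↦ 0]`.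
* `PendantPeeling.lightness_eq_of_pendant`: `I_w(a) = I_{w₀}(a)` for every `a ≠ v` — one-bond decomposition at `e`
  (`stub_oneBondDecomp_k15`, `ChampionStability.real_update_one_eq`) and, on configurations inside the support of `w₀`
  (`CutObserver.TwoGate.measureReal_preimage_off`), `v` is isolated, so opening `e` changes no reachability between vertices
  other than `v` (`RelayNbhd.reachable_insert_iff_of_isolated`).  Hence `c` is a champion of `w₀` and `μ(w₀) < μ(w)`.
* `CutObserver.setCS_raise_edge` at `e`: `CS_w(S,c)` follows from `CS_{w₀}(S, c)` and `CS_{w₀}(S ∪ {g}, c)`.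
  In `w₀` the vertex `v` is (almost surely) isolated, so the two events of `CS_{w₀}(S, c)` are those of
  `CS_{w₀}(S ∖ {v}, c)` (`PendantPeeling.setCS_events_of_isolated`), which is the induction hypothesis; `CS_{w₀}(S ∪ {g}, c)`
  is `observerSet_le_of_lonelier` when `g ∈ A` (then `I_{w₀}(g) ≤ I_{w₀}(c)`), the induction hypothesis when `g ∉ A`.

Consequence for the line: the STEP hypothesis `hML` of `setCS_of_step` needs to be established only for observer sets
WITHOUT pendant vertices; together with `TwoGate.step_of_twoGate` this proves the STEP for every `S` whose pendant-free
core has its outside neighbours inside two vertices (e.g. all "star + pendants" S-laws of the census).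
-/

noncomputable section

namespace Summit.CriticalPhenomena.PercolationContinuityZ3.Theorems

open MeasureTheory Set Literature.Probability.LatticeModels Literature.Probability.Percolation
open scoped Classical BigOperators

variable {n : ℕ}

namespace PendantPeeling

open CutObserver ChampionStability

/-- Support transfer: an event may be read off `ω ∩ {w ≠ 0}`. [folklore] -/
theorem measureReal_eq_inter_support (w : Sym2 (Fin n) → unitInterval) (T : Set (BondConfig (Fin n))) :
    (prodBernoulli w).real T = (prodBernoulli w).real {ω : BondConfig (Fin n) | ω ∩ {e | w e ≠ 0} ∈ T} := by
  rw [TwoGate.measureReal_preimage_off w {e | w e ≠ 0} T]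
  congr 2
  funext e
  by_cases h : w e ≠ 0
  · simp [h]
  · push Not at h
    simp [h]

/-- If the only positive-weight pair at `v` is `s(v,g)`, then inside the support of `w[s(v,g) ↦ 0]` the vertex `v` is
isolated. [folklore] -/
theorem isolated_of_pendant (w : Sym2 (Fin n) → unitInterval) {v g : Fin n}
    (hpend : ∀ u : Fin n, u ≠ v → u ≠ g → w s(v, u) = 0) (ω : BondConfig (Fin n)) :
    ∀ u : Fin n, u ≠ v → s(v, u) ∉ ω ∩ {e | Function.update w s(v, g) 0 e ≠ 0} := by
  intro u huv hmem
  have h := hmem.2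
  simp only [mem_setOf_eq] at h
  by_cases hug : u = g
  · subst hug; simp at h
  · have hne : s(v, u) ≠ s(v, g) := by
      intro heq
      rw [Sym2.eq_iff] at heq
      rcases heq with h' | h'
      · exact hug h'.2
      · exact huv h'.2
    rw [Function.update_of_ne hne] at h
    exact h (hpend u huv hug)

/-- **Lightness is unchanged by deleting a pendant edge at a non-relay vertex.**  If the only positive-weight pair at
`v` is `s(v,g)` (`g ≠ v`) and `a ≠ v`, then `μ_w{|π(a)| ≤ j} = μ_{w[s(v,g) ↦ 0]}{|π(a)| ≤ j}` provided `v ∉ A`. -/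
theorem lightness_eq_of_pendant (w : Sym2 (Fin n) → unitInterval) (A : Finset (Fin n)) (j : ℕ) {v g a : Fin n}
    (hgv : g ≠ v) (hvA : v ∉ A) (hav : a ≠ v)
    (hpend : ∀ u : Fin n, u ≠ v → u ≠ g → w s(v, u) = 0) :
    (prodBernoulli w).real {ω : BondConfig (Fin n) | (A.filter fun z => ω ∈ openConn a z).card ≤ j} =
      (prodBernoulli (Function.update w s(v, g) 0)).real
        {ω : BondConfig (Fin n) | (A.filter fun z => ω ∈ openConn a z).card ≤ j} := by
  set e : Sym2 (Fin n) := s(v, g) with he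
  set w₀ := Function.update w e 0 with hw₀
  set Ra := {ω : BondConfig (Fin n) | (A.filter fun z => ω ∈ openConn a z).card ≤ j} with hRa
  have hw₀e : w₀ s(v, g) = 0 := by simp [hw₀, he]
  have hw₁ : Function.update w e 1 = Function.update w₀ s(v, g) 1 := by rw [hw₀, he, Function.update_idem]
  -- one-bond decomposition at `e`
  have hdec := stub_oneBondDecomp_k15 n w e Ra
  rw [hw₁, real_update_one_eq w₀ hw₀e Ra] at hdec
  -- the pulled-back event equals `Ra` inside the support of `w₀`
  set D : Set (Sym2 (Fin n)) := {e' | w₀ e' ≠ 0} with hD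
  have hiso : ∀ ω : BondConfig (Fin n), ∀ u : Fin n, u ≠ v → s(v, u) ∉ ω ∩ D :=
    fun ω => isolated_of_pendant w hpend ω
  have hkey : {ω : BondConfig (Fin n) | ω ∩ D ∈ (fun ω : BondConfig (Fin n) => insert s(v, g) ω) ⁻¹' Ra} =
      {ω : BondConfig (Fin n) | ω ∩ D ∈ Ra} := by
    ext ω
    simp only [mem_setOf_eq, mem_preimage, hRa]
    have hfilt : (A.filter fun z => insert s(v, g) (ω ∩ D) ∈ openConn a z) =
        (A.filter fun z => ω ∩ D ∈ openConn a z) := by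
      refine Finset.filter_congr fun z hz => ?_
      have hzv : z ≠ v := fun h => hvA (h ▸ hz)
      simp only [TwoGate.mem_openConn_iff']
      rw [RelayNbhd.reachable_insert_iff_of_isolated hgv.symm (hiso ω) hav hzv]
      constructor
      · rintro (h | ⟨h1, h2⟩)
        · exact h
        · exact h1.trans h2
      · exact fun h => Or.inl h
    rw [hfilt]
  have h1 : (prodBernoulli w₀).real ((fun ω : BondConfig (Fin n) => insert s(v, g) ω) ⁻¹' Ra) =
      (prodBernoulli w₀).real Ra := by
    rw [measureReal_eq_inter_support w₀ ((fun ω : BondConfig (Fin n) => insert s(v, g) ω) ⁻¹' Ra),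
      measureReal_eq_inter_support w₀ Ra]
    exact congrArg _ hkey
  rw [h1] at hdec
  rw [hdec]; ring

/-- **The `CS` events of `S` and of `S ∖ {v}` agree when `v ∉ A` is isolated in the support.**  For
`w₀` vanishing on every non-diagonal pair at `v`, `v ∈ S`, `S` disjoint from `A`, and a witness `c ≠ v`:
both events of `CS_{w₀}(S, c)` have the same `μ_{w₀}`-measure as those of `CS_{w₀}(S.erase v, c)`. -/
theorem setCS_events_of_isolated (w₀ : Sym2 (Fin n) → unitInterval) (A S : Finset (Fin n)) (v c : Fin n) (j : ℕ)
    (hSA : Disjoint S A) (hvS : v ∈ S) (hcv : c ≠ v)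
    (hiso : ∀ u : Fin n, u ≠ v → w₀ s(v, u) = 0) :
    (prodBernoulli w₀).real {ω : BondConfig (Fin n) |
        (∀ x ∈ S, ω ∉ openConn c x) ∧ 1 ≤ (A.filter fun z => ∃ x ∈ S, ω ∈ openConn x z).card ∧
        (A.filter fun z => ∃ x ∈ S, ω ∈ openConn x z).card ≤ j} =
      (prodBernoulli w₀).real {ω : BondConfig (Fin n) |
        (∀ x ∈ S.erase v, ω ∉ openConn c x) ∧ 1 ≤ (A.filter fun z => ∃ x ∈ S.erase v, ω ∈ openConn x z).card ∧
        (A.filter fun z => ∃ x ∈ S.erase v, ω ∈ openConn x z).card ≤ j} ∧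
    (prodBernoulli w₀).real {ω : BondConfig (Fin n) |
        (∀ x ∈ S, ω ∉ openConn c x) ∧ (A.filter fun z => ω ∈ openConn c z).card ≤ j} =
      (prodBernoulli w₀).real {ω : BondConfig (Fin n) |
        (∀ x ∈ S.erase v, ω ∉ openConn c x) ∧ (A.filter fun z => ω ∈ openConn c z).card ≤ j} := by
  set D : Set (Sym2 (Fin n)) := {e' | w₀ e' ≠ 0} with hD
  have hisoD : ∀ ω : BondConfig (Fin n), ∀ u : Fin n, u ≠ v → s(v, u) ∉ ω ∩ D := by
    intro ω u huv hmem
    exact hmem.2 (hiso u huv)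
  -- inside the support, `v` reaches only itself
  have hreach_v : ∀ ω : BondConfig (Fin n), ∀ u : Fin n, (openGraph (ω ∩ D)).Reachable v u → u = v :=
    fun ω u h => RelayNbhd.eq_of_reachable_of_isolated (hisoD ω) h
  have hsep : ∀ ω : BondConfig (Fin n), (∀ x ∈ S, ω ∩ D ∉ openConn c x) ↔ (∀ x ∈ S.erase v, ω ∩ D ∉ openConn c x) := by
    intro ω
    constructor
    · exact fun h x hx => h x (Finset.mem_of_mem_erase hx)
    · intro h x hx
      by_cases hxv : x = v
      · subst hxv
        intro hc
        exact hcv (hreach_v ω c (SimpleGraph.Reachable.symm hc))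
      · exact h x (Finset.mem_erase.2 ⟨hxv, hx⟩)
  have hfilt : ∀ ω : BondConfig (Fin n), (A.filter fun z => ∃ x ∈ S, ω ∩ D ∈ openConn x z) =
      (A.filter fun z => ∃ x ∈ S.erase v, ω ∩ D ∈ openConn x z) := by
    intro ω
    refine Finset.filter_congr fun z hz => ?_
    constructor
    · rintro ⟨x, hx, hxz⟩
      by_cases hxv : x = v
      · subst hxv
        have hzv : z = x := hreach_v ω z hxz
        exact absurd (hzv ▸ hz) (Finset.disjoint_left.1 hSA hvS)
      · exact ⟨x, Finset.mem_erase.2 ⟨hxv, hx⟩, hxz⟩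
    · rintro ⟨x, hx, hxz⟩
      exact ⟨x, Finset.mem_of_mem_erase hx, hxz⟩
  constructor
  · rw [measureReal_eq_inter_support w₀ {ω : BondConfig (Fin n) |
        (∀ x ∈ S, ω ∉ openConn c x) ∧ 1 ≤ (A.filter fun z => ∃ x ∈ S, ω ∈ openConn x z).card ∧
        (A.filter fun z => ∃ x ∈ S, ω ∈ openConn x z).card ≤ j},
      measureReal_eq_inter_support w₀ {ω : BondConfig (Fin n) |
        (∀ x ∈ S.erase v, ω ∉ openConn c x) ∧ 1 ≤ (A.filter fun z => ∃ x ∈ S.erase v, ω ∈ openConn x z).card ∧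
        (A.filter fun z => ∃ x ∈ S.erase v, ω ∈ openConn x z).card ≤ j}]
    congr 1
    ext ω
    simp only [mem_setOf_eq]
    rw [hsep ω, hfilt ω]
  · rw [measureReal_eq_inter_support w₀ {ω : BondConfig (Fin n) |
        (∀ x ∈ S, ω ∉ openConn c x) ∧ (A.filter fun z => ω ∈ openConn c z).card ≤ j},
      measureReal_eq_inter_support w₀ {ω : BondConfig (Fin n) |
        (∀ x ∈ S.erase v, ω ∉ openConn c x) ∧ (A.filter fun z => ω ∈ openConn c z).card ≤ j}]
    congr 1
    ext ω
    simp only [mem_setOf_eq]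
    rw [hsep ω]

/-- **Pendant peeling: the STEP of `setCS_of_step` when `S` has a pendant vertex.**  See the file header.
The induction hypothesis `ih` is taken in exactly the form used by `setCS_of_step` / `TwoGate.step_of_twoGate`. -/
theorem step_of_pendant (w : Sym2 (Fin n) → unitInterval) (A S : Finset (Fin n)) (c v g : Fin n) (j : ℕ)
    (hSA : Disjoint S A) (hcA : c ∈ A) (hvS : v ∈ S) (hgv : g ≠ v) (hS2 : 2 ≤ S.card)
    (hwg : w s(v, g) ≠ 0) (hpend : ∀ u : Fin n, u ≠ v → u ≠ g → w s(v, u) = 0)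
    (hchamp : ∀ a ∈ A,
      (prodBernoulli w).real {ω : BondConfig (Fin n) | (A.filter fun b => ω ∈ openConn a b).card ≤ j} ≤
        (prodBernoulli w).real {ω : BondConfig (Fin n) | (A.filter fun b => ω ∈ openConn c b).card ≤ j})
    (ih : ∀ w' : Sym2 (Fin n) → unitInterval,
      (Fintype.card (Sym2 (Fin n)) + 1) * (Finset.univ.filter fun e => w' e ≠ 0).card +
          (Finset.univ.filter fun e => w' e ≠ 0 ∧ w' e ≠ 1).card <
        (Fintype.card (Sym2 (Fin n)) + 1) * (Finset.univ.filter fun e => w e ≠ 0).card +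
          (Finset.univ.filter fun e => w e ≠ 0 ∧ w e ≠ 1).card →
      ∀ (T : Finset (Fin n)) (x : Fin n), Disjoint T A → T.Nonempty → x ∈ A →
      (∀ a ∈ A, (prodBernoulli w').real {ω : BondConfig (Fin n) | (A.filter fun b => ω ∈ openConn a b).card ≤ j} ≤
        (prodBernoulli w').real {ω : BondConfig (Fin n) | (A.filter fun b => ω ∈ openConn x b).card ≤ j}) →
      (prodBernoulli w').real {ω : BondConfig (Fin n) | (∀ u ∈ T, ω ∉ openConn x u) ∧
          1 ≤ (A.filter fun b => ∃ u ∈ T, ω ∈ openConn u b).card ∧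
          (A.filter fun b => ∃ u ∈ T, ω ∈ openConn u b).card ≤ j} ≤
        (prodBernoulli w').real {ω : BondConfig (Fin n) | (∀ u ∈ T, ω ∉ openConn x u) ∧
          (A.filter fun b => ω ∈ openConn x b).card ≤ j}) :
    (prodBernoulli w).real {ω : BondConfig (Fin n) | (∀ x ∈ S, ω ∉ openConn c x) ∧
        1 ≤ (A.filter fun b => ∃ x ∈ S, ω ∈ openConn x b).card ∧
        (A.filter fun b => ∃ x ∈ S, ω ∈ openConn x b).card ≤ j} ≤
      (prodBernoulli w).real {ω : BondConfig (Fin n) | (∀ x ∈ S, ω ∉ openConn c x) ∧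
        (A.filter fun b => ω ∈ openConn c b).card ≤ j} := by
  set e : Sym2 (Fin n) := s(v, g) with he
  set w₀ := Function.update w e 0 with hw₀
  have hvA : v ∉ A := Finset.disjoint_left.1 hSA hvS
  have hcv : c ≠ v := fun h => hvA (h ▸ hcA)
  -- `v` is isolated for `w₀`
  have hiso : ∀ u : Fin n, u ≠ v → w₀ s(v, u) = 0 := by
    intro u huv
    by_cases hug : u = g
    · subst hug; simp [hw₀, he]
    · have hne : s(v, u) ≠ e := by
        intro heq
        rw [he, Sym2.eq_iff] at heq
        rcases heq with h' | h'
        · exact hug h'.2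
        · exact huv h'.2
      rw [hw₀, Function.update_of_ne hne]
      exact hpend u huv hug
  -- lightness is the same for `w` and `w₀`; `c` stays champion
  have hI : ∀ a ∈ A, (prodBernoulli w).real {ω : BondConfig (Fin n) | (A.filter fun b => ω ∈ openConn a b).card ≤ j} =
      (prodBernoulli w₀).real {ω : BondConfig (Fin n) | (A.filter fun b => ω ∈ openConn a b).card ≤ j} := by
    intro a ha
    have hav : a ≠ v := fun h => hvA (h ▸ ha)
    exact lightness_eq_of_pendant w A j hgv hvA hav hpend
  have hchamp₀ : ∀ a ∈ A,
      (prodBernoulli w₀).real {ω : BondConfig (Fin n) | (A.filter fun b => ω ∈ openConn a b).card ≤ j} ≤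
        (prodBernoulli w₀).real {ω : BondConfig (Fin n) | (A.filter fun b => ω ∈ openConn c b).card ≤ j} := by
    intro a ha
    rw [← hI a ha, ← hI c hcA]
    exact hchamp a ha
  -- `μ(w₀) < μ(w)`
  have hnz : (Finset.univ.filter fun e' => w₀ e' ≠ 0) ⊆ (Finset.univ.filter fun e' => w e' ≠ 0).erase e := by
    intro e' he'
    rw [Finset.mem_filter] at he'
    rw [Finset.mem_erase, Finset.mem_filter]
    by_cases hee : e' = e
    · subst hee; simp [hw₀] at he'
    · rw [hw₀, Function.update_of_ne hee] at he'
      exact ⟨hee, Finset.mem_univ _, he'.2⟩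
  have hfr : (Finset.univ.filter fun e' => w₀ e' ≠ 0 ∧ w₀ e' ≠ 1) ⊆
      (Finset.univ.filter fun e' => w e' ≠ 0 ∧ w e' ≠ 1) := by
    intro e' he'
    rw [Finset.mem_filter] at he' ⊢
    by_cases hee : e' = e
    · subst hee; simp [hw₀] at he'
    · rw [hw₀, Function.update_of_ne hee] at he'
      exact ⟨Finset.mem_univ _, he'.2⟩
  have hemem : e ∈ Finset.univ.filter fun e' => w e' ≠ 0 := Finset.mem_filter.2 ⟨Finset.mem_univ _, hwg⟩
  have hlt : (Fintype.card (Sym2 (Fin n)) + 1) * (Finset.univ.filter fun e' => w₀ e' ≠ 0).card +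
        (Finset.univ.filter fun e' => w₀ e' ≠ 0 ∧ w₀ e' ≠ 1).card <
      (Fintype.card (Sym2 (Fin n)) + 1) * (Finset.univ.filter fun e' => w e' ≠ 0).card +
        (Finset.univ.filter fun e' => w e' ≠ 0 ∧ w e' ≠ 1).card := by
    have h1 := Finset.card_le_card hnz
    rw [Finset.card_erase_of_mem hemem] at h1
    have h2 := Finset.card_le_card hfr
    have h3 : 0 < (Finset.univ.filter fun e' => w e' ≠ 0).card := Finset.card_pos.2 ⟨e, hemem⟩
    have h4 : (Finset.univ.filter fun e' => w₀ e' ≠ 0).card + 1 ≤ (Finset.univ.filter fun e' => w e' ≠ 0).card := by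
      omega
    nlinarith
  -- `CS_{w₀}(S ∖ v, c)` from the induction hypothesis, transported to `CS_{w₀}(S, c)`
  have hS'ne : (S.erase v).Nonempty := by
    rw [← Finset.card_pos, Finset.card_erase_of_mem hvS]; omega
  have hS'A : Disjoint (S.erase v) A := Finset.disjoint_of_subset_left (Finset.erase_subset _ _) hSA
  have h₀' := ih w₀ hlt (S.erase v) c hS'A hS'ne hcA hchamp₀
  obtain ⟨hL, hR⟩ := setCS_events_of_isolated w₀ A S v c j hSA hvS hcv hiso
  have h₀ : (prodBernoulli w₀).real {ω : BondConfig (Fin n) |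
        (∀ x ∈ S, ω ∉ openConn c x) ∧ 1 ≤ (A.filter fun z => ∃ x ∈ S, ω ∈ openConn x z).card ∧
        (A.filter fun z => ∃ x ∈ S, ω ∈ openConn x z).card ≤ j} ≤
      (prodBernoulli w₀).real {ω : BondConfig (Fin n) |
        (∀ x ∈ S, ω ∉ openConn c x) ∧ (A.filter fun z => ω ∈ openConn c z).card ≤ j} := by
    rw [hL, hR]; exact h₀'
  -- `CS_{w₀}(S ∪ {g}, c)`
  have h₁ : (prodBernoulli w₀).real {ω : BondConfig (Fin n) |
        (∀ x ∈ insert g S, ω ∉ openConn c x) ∧ 1 ≤ (A.filter fun z => ∃ x ∈ insert g S, ω ∈ openConn x z).card ∧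
        (A.filter fun z => ∃ x ∈ insert g S, ω ∈ openConn x z).card ≤ j} ≤
      (prodBernoulli w₀).real {ω : BondConfig (Fin n) |
        (∀ x ∈ insert g S, ω ∉ openConn c x) ∧ (A.filter fun z => ω ∈ openConn c z).card ≤ j} := by
    by_cases hgA : g ∈ A
    · have H := observerSet_le_of_lonelier w₀ A (insert g S) g c (Finset.mem_insert_self g S) j (hchamp₀ g hgA)
      convert H using 7 <;> first | rfl | (congr 1; ext z; simp only [Finset.mem_filter])
    · have hTA : Disjoint (insert g S) A := by
        rw [Finset.disjoint_insert_left]; exact ⟨hgA, hSA⟩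
      exact ih w₀ hlt (insert g S) c hTA (Finset.insert_nonempty g S) hcA hchamp₀
  exact setCS_raise_edge w A S v g c j hvS hgv.symm h₀ h₁

end PendantPeeling

end Summit.CriticalPhenomena.PercolationContinuityZ3.Theorems
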